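import Summits.Ventures.CertifiedManyBodySolver.Rows.TorusCeilingTTPrimeSharp
import Summits.Ventures.CertifiedManyBodySolver.Rows.TorusCeilingSectorEngine
import Summits.Ventures.CertifiedQuantumChemistry.Rows.SectorRows
import Literature.MathematicalPhysics.QuantumChemistry.SecondQuantizedHamiltonian
import Literature.MathematicalPhysics.QuantumLattice.HubbardNNNHoppingWindowCertificate
import Literature.MathematicalPhysics.QuantumLattice.HubbardSpinFlipSymmetry
import HarnessLib

/-!
# Torus ceiling VII(b) — `t–t'` window certificates bound EVERY sector `(N↑, N↓)` of every `L × L`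
# torus with `L ≥ max(3, M + 1)` (sharp torus hypothesis)

HONEST FRAMING: first certified bounds; not a superconductivity verdict; every number certified or
labelled float.

The tree's `t–t'` window-certificate transport
(`Literature.MathematicalPhysics.QuantumLattice.groundEnergy_hubbardTorusTT'_div_ge_of_window_certificate`,
Han 2020 §3 for the `t–t'` model of Xu et al. 2024 eq. (1)) bounds the `S^z = 0`, `N = 2n` ground
energy of the `t–t'` torus `hubbardTorusTT' L t t' U` by the certified constant of a window certificate,
for tori with `x ↦ x mod L` injective on the THICKENED window `thicken Λ' 1` (`L ≥ M + 3` for a window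
of coordinate spread `M`). This file proves the CAL-ceiling form:

* `hubbardTorusTT'_minEnergyOn_upDownSector_div_ge_of_window_certificate` — with EXACTLY the tree's
  certificate data, for every `L ≥ 3` with `x ↦ x mod L` injective on `Λ'` ONLY (`L ≥ M + 1`; the sharp
  commutator pull-back `hubbardTorusTT'_commutator_fermionEmbed_sharp` of Part VII(a)) and EVERY sector
  `(N↑, N↓) = (a, b)`, `a, b ≤ L²`, with the density rows evaluated per species:
  `c − Σ‖aₖ‖ + μ↑ (a/L² − ν) + μ↓ (b/L² − ν) ≤ E^{tt'}_L(a, b) / L²` (the sector-abstracted engine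
  `torus_minEnergyOn_sector_div_ge_of_local_certificate` of `TorusCeilingSectorEngine`);
* `relabel_spinSwap_hubbardTorusTT'`, `minEnergyOn_hubbardTorusTT'_spinSwap` — the spin exchange fixes
  `H^{tt'}_L`, so `E^{tt'}_L(b, a) = E^{tt'}_L(a, b)`;
* `hubbardTorusTT'_minEnergyOn_upDownSector_div_ge_of_window_certificate_avg` — averaging over `(a, b)`
  and `(b, a)`: `c − Σ‖aₖ‖ + (Σ_σ μ_σ)((a + b)/(2L²) − ν) ≤ E^{tt'}_L(a, b) / L²`; at the certificate's
  filling `(a + b)/(2L²) = ν` the density rows drop out, so the certified constant is a lower bound for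
  the `t–t'` torus energy density in EVERY particle-number sector at that filling — odd `a + b` and
  `S^z ≠ 0` included;
* `hubbardTorusTT'_groundEnergy_div_ge_of_window_certificate_sharp` — the tree's conclusion
  (`groundEnergy … (2n) / L²`) under the sharp hypothesis.

Consequence for the CAL ceiling page (cal-3, kernel column K7): the exact-diagonalisation rows of the
`3 × 3` and `4 × 4` `t–t'` tori (`t' = −1/4`, periodic, every sector) are KERNEL-admissible caps of every
translation + EOM window certificate of the footprint classes `(≤3,≤3)` resp. `(4,4)`; the numerical rows
themselves are ED references (certified or labelled float), not part of this file.
[cite: Han2020Bootstrap, §3] [cite: XuEtAl2024, eq. (1)] [cite: LiebPRL1989, proof of Theorem 1]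
[cite: KullEtAl2024, §5.3]
-/

noncomputable section

open Matrix Finset
open Literature.MathematicalPhysics.QuantumLattice
open Literature.MathematicalPhysics.QuantumFieldTheory hiding Site
open Literature.MathematicalPhysics.QuantumManyBody.StateRelaxation
open Literature.Probability.LatticeModels
open HubbardWave0
open scoped ComplexOrder ComplexConjugate

namespace Summit.Ventures.CertifiedManyBodySolver.Rows

/-! ### Window certificate ⇒ every sector `(N↑, N↓)` of the `t–t'` torus, sharp torus hypothesis -/

section TTPrimeWindowSectors

/-- **`t–t'` window certificate ⇒ energy per site of the `L × L` torus in EVERY sector `(N↑, N↓) = (a, b)`,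
sharp torus hypothesis.** Fix a window `Λ' ⊆ ℤ²` containing the unit cube `thicken {0} 1`, an inner
region `Λ ⊆ Λ'` with all eight king-move neighbours of every site of `Λ` inside `Λ'` (`thicken Λ 1 ⊆ Λ'`),
real `μ_↑, μ_↓, ν`, and the identity in `𝔄_{Λ'}` of the tree's
`groundEnergy_hubbardTorusTT'_div_ge_of_window_certificate` (objective `Γ(incl) E^{tt'}_Φ`, Gram form,
EOM rows `H^{tt'}_{Λ'} Bₖ − Bₖ H^{tt'}_{Λ'}` with `Bₖ ∈ 𝔄_Λ`, translation rows, charged words, anti-Hermitian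
parts, residual words). Then for every torus side `L ≥ 3` with `x ↦ x mod L` injective on `Λ'` (ONLY —
`L ≥ M + 1` for a window of coordinate spread `M`) and every `a, b ≤ L²`:
`c − Σₖ ‖aₖ‖ + μ_↑ (a/L² − ν) + μ_↓ (b/L² − ν) ≤ minEnergyOn (hubbardTorusTT' L t t' U) (szSector (a+b) ((a−b)/2)) / L²`.
Proof: the tree proof on the sector-abstracted engine `torus_minEnergyOn_sector_div_ge_of_local_certificate`
(`N_σ` acts as `a` resp. `b` on the sector — `CertifiedQuantumChemistry.spinNumber_mulVec_of_mem_upDownSector`;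
the sector is non-trivial — `QuantumChemistry.szSector_upDown_ne_bot`), with the EOM rows pulled back by
the sharp commutator lemma `hubbardTorusTT'_commutator_fermionEmbed_sharp`. [cite: Han2020Bootstrap, §3]
[cite: XuEtAl2024, eq. (1)] [cite: LiebPRL1989, eq. (2)] -/
theorem hubbardTorusTT'_minEnergyOn_upDownSector_div_ge_of_window_certificate (t t' U : ℝ) {L : ℕ} [NeZero L]
    (hL : 3 ≤ L) {nu nd : ℕ} (hnu : nu ≤ Fintype.card (FermionTorus 2 L))
    (hnd : nd ≤ Fintype.card (FermionTorus 2 L))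
    {Λ Λ' : Finset (Site 2)} (hΛ : Λ ⊆ Λ') (h8 : thicken Λ 1 ⊆ Λ')
    (h0 : thicken ({0} : Finset (Site 2)) 1 ⊆ Λ') (hz : (0 : Site 2) ∈ Λ')
    (hInj' : Set.InjOn (Torus.proj (d := 2) L) ↑Λ')
    (μ : Fin 2 → ℝ) (ν : ℝ)
    {m : Type*} [Fintype m] [DecidableEq m] {Λm : Matrix m m ℂ} (hΛm : Λm.PosSemidef)
    (O : m → FermionOp Λ')
    {κ : Type*} (s : Finset κ) (B : κ → FermionOp Λ)
    {ι : Type*} (tt : Finset ι) (v : ι → Site 2) (hsh : ∀ l, shiftSet (v l) Λ ⊆ Λ') (Y : ι → FermionOp Λ)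
    {γ : Type*} (u : Finset γ) (b : γ → ℂ) (cw : γ → List (Orb (PolySite Λ') × Bool))
    (hcw : ∀ j ∈ u, ladderCharge (cw j) ≠ 0 ∨ ladderSpinCharge (cw j) ≠ 0)
    {δ : Type*} (ah : Finset δ) (dc : δ → ℝ) (V : δ → FermionOp Λ')
    {κ'' : Type*} (w : Finset κ'') (a : κ'' → ℂ) (word : κ'' → List (Orb (PolySite Λ') × Bool)) {c : ℝ}
    (hcert : fermionEmbed (PolySite.incl h0) ((hubbardTTPrimeFermionInteraction t t' U).meanEnergyObs 1) -
        (c : ℂ) • (1 : FermionOp Λ') -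
        ∑ σ : Fin 2, ((μ σ : ℝ) : ℂ) • (nAt 0 hz σ - ((ν : ℝ) : ℂ) • (1 : FermionOp Λ')) =
      gramForm Λm O +
        (∑ k ∈ s, ((hubbardTTPrimeFermionInteraction t t' U).localHamiltonian Λ' * fermionEmbed (PolySite.incl hΛ) (B k) -
            fermionEmbed (PolySite.incl hΛ) (B k) * (hubbardTTPrimeFermionInteraction t t' U).localHamiltonian Λ') +
          ∑ l ∈ tt, (fermionEmbed (PolySite.incl (hsh l)) (fermionEmbed (PolySite.shiftEmb (v l) Λ) (Y l)) -
            fermionEmbed (PolySite.incl hΛ) (Y l)) +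
          ∑ j ∈ u, b j • ladderWord (cw j)) +
        (∑ m' ∈ ah, ((dc m' : ℝ) : ℂ) • ((V m')ᴴ - V m') + ∑ k ∈ w, a k • ladderWord (word k))) :
    c - ∑ k ∈ w, ‖a k‖ + (μ 0 * ((nu : ℝ) / (L : ℝ) ^ 2 - ν) + μ 1 * ((nd : ℝ) / (L : ℝ) ^ 2 - ν)) ≤
      (hubbardTorusTT' L t t' U).minEnergyOn (szSector (nu + nd) (((nu : ℝ) - nd) / 2)) / (L : ℝ) ^ 2 := by
  letI instDE : DecidableEq (FermionTorus 2 L) := LinearOrder.toDecidableEq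
  -- the pull-back homomorphism and its restrictions
  have hInjΛ : Set.InjOn (Torus.proj (d := 2) L) ↑Λ := hInj'.mono (by exact_mod_cast hΛ)
  have hInj0 : Set.InjOn (Torus.proj (d := 2) L) ↑(thicken ({0} : Finset (Site 2)) 1) :=
    hInj'.mono (by exact_mod_cast h0)
  set Γ' := fermionEmbed (PolySite.toTorusEmb L hInj') with hΓ'
  set ΓΛ := fermionEmbed (PolySite.toTorusEmb L hInjΛ) with hΓΛ
  set H := hubbardTorusTT' L t t' U with hH
  set EΦ := (hubbardTTPrimeFermionInteraction t t' U).meanEnergyObs 1 with hEΦ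
  -- the sector
  set K : Submodule ℂ (Fock (Orb (FermionTorus 2 L))) := szSector (nu + nd) (((nu : ℝ) - nd) / 2) with hKdef
  have hK : K ≠ ⊥ := Literature.MathematicalPhysics.QuantumChemistry.szSector_upDown_ne_bot hnu hnd
  -- Hamiltonian data
  have hA : H.IsHermitian := hubbardTorusTT'_isHermitian L t t' U
  have hKA : ∀ ψ ∈ K, H *ᵥ ψ ∈ K := fun ψ hψ => mulVec_hubbardTorusTT'_mem_szSector L t t' U hψ
  have hKT : ∀ v' : TorusSite 2 L, ∀ ψ ∈ K, (fockTranslate v').val *ᵥ ψ ∈ K :=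
    fun v' ψ hψ => fockTranslate_mulVec_mem_szSector v' hψ
  have hKT' : ∀ v' : TorusSite 2 L, ∀ ψ ∈ K, (fockTranslate v').valᴴ *ᵥ ψ ∈ K :=
    fun v' ψ hψ => fockTranslate_conjTranspose_mulVec_mem_szSector v' hψ
  have hAT : ∀ v' : TorusSite 2 L, (fockTranslate v').val * H = H * (fockTranslate v').val := fun v' =>
    (fockTranslate_commute_hubbardTorusTT' L v' t t' U).eq
  -- the objective: `Γ' (Γ(incl) E_Φ) = Γ(ι₀) E_Φ`, whose translates sum to `H`
  set X := Γ' (fermionEmbed (PolySite.incl h0) EΦ) with hX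
  have hX0 : X = fermionEmbed (PolySite.toTorusEmb L hInj0) EΦ := fermionEmbed_toTorusEmb_incl h0 hInj' EΦ
  have hsum : ∑ v' : TorusSite 2 L, (fockTranslate v').val * X * (fockTranslate v').valᴴ = H := by
    rw [hX0]
    have h := sum_relabel_translate_hubbardTTPrime_meanEnergyObs (L := L) t' t U hL
    simp_rw [relabel_eq_fockRelabel_conj] at h
    exact h
  -- density observables, acting as `nu` resp. `nd` on the sector
  set D : Fin 2 → Matrix (Finset (Orb (FermionTorus 2 L))) (Finset (Orb (FermionTorus 2 L))) ℂ :=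
    fun σ => numberOp (FermionTorus.ofTorusSite (0 : TorusSite 2 L)) σ with hD
  set G : Fin 2 → Matrix (Finset (Orb (FermionTorus 2 L))) (Finset (Orb (FermionTorus 2 L))) ℂ :=
    fun σ => ∑ y : FermionTorus 2 L, numberOp y σ with hG
  set gv : Fin 2 → ℝ := fun σ => if σ = 0 then (nu : ℝ) else (nd : ℝ) with hgv
  have hDΓ : ∀ σ, Γ' (nAt 0 hz σ) = D σ := fun σ => fermionEmbed_toTorusEmb_nAt_zero hz hInj' σ
  have hDsum : ∀ σ ∈ (Finset.univ : Finset (Fin 2)),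
      ∑ v' : TorusSite 2 L, (fockTranslate v').val * D σ * (fockTranslate v').valᴴ = G σ :=
    fun σ _ => sum_conj_fockTranslate_numberOp 0 σ
  have hGh : ∀ σ ∈ (Finset.univ : Finset (Fin 2)), (G σ).IsHermitian := fun σ _ => isHermitian_sum_numberOp σ
  have hGs : ∀ σ ∈ (Finset.univ : Finset (Fin 2)), ∀ ψ ∈ K, G σ *ᵥ ψ = (((gv σ : ℝ) : ℝ) : ℂ) • ψ := by
    intro σ _ ψ hψ
    rw [hG, hgv]
    exact Summit.Ventures.CertifiedQuantumChemistry.spinNumber_mulVec_of_mem_upDownSector σ hψ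
  -- symmetry (translation) family
  set Us : ι → Matrix (Finset (Orb (FermionTorus 2 L))) (Finset (Orb (FermionTorus 2 L))) ℂ :=
    fun l => (fockTranslate (Torus.proj L (v l))).val with hUs
  set Yt : ι → Matrix (Finset (Orb (FermionTorus 2 L))) (Finset (Orb (FermionTorus 2 L))) ℂ :=
    fun l => ΓΛ (Y l) with hYt
  have hU : ∀ l ∈ tt, Us l * H = H * Us l := fun l _ => (fockTranslate_commute_hubbardTorusTT' L _ t t' U).eq
  have hUK : ∀ l ∈ tt, ∀ ψ ∈ K, Us l *ᵥ ψ ∈ K := fun l _ ψ hψ => fockTranslate_mulVec_mem_szSector _ hψ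
  have hUK' : ∀ l ∈ tt, ∀ ψ ∈ K, (Us l)ᴴ *ᵥ ψ ∈ K :=
    fun l _ ψ hψ => fockTranslate_conjTranspose_mulVec_mem_szSector _ hψ
  have hUU : ∀ l ∈ tt, (Us l)ᴴ * Us l = 1 := fun l _ => fockTranslate_conjTranspose_mul_self _
  -- charge family (charged words as commutators with `N̂` / `S^z`)
  set emb : Orb (PolySite Λ') × Bool → Orb (FermionTorus 2 L) × Bool :=
    fun p => (Orb.embMap (PolySite.toTorusEmb L hInj') p.1, p.2) with hemb
  set C : γ → Matrix (Finset (Orb (FermionTorus 2 L))) (Finset (Orb (FermionTorus 2 L))) ℂ :=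
    fun j => if ladderCharge ((cw j).map emb) ≠ 0 then totalNumber else HubbardWave0.spinZ with hC
  set W : γ → Matrix (Finset (Orb (FermionTorus 2 L))) (Finset (Orb (FermionTorus 2 L))) ℂ :=
    fun j => (b j / (if ladderCharge ((cw j).map emb) ≠ 0 then ((ladderCharge ((cw j).map emb) : ℤ) : ℂ)
      else ((ladderSpinCharge ((cw j).map emb) : ℤ) : ℂ) / 2)) • ladderWord ((cw j).map emb) with hW
  have hHN : Commute H totalNumber := hubbardTorusTT'_commute_totalNumber L t t' U
  have hHS : Commute H HubbardWave0.spinZ := hubbardTorusTT'_commute_spinZ L t t' U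
  have hC1 : ∀ j ∈ u, C j * H = H * C j := by
    intro j _
    by_cases hq : ladderCharge ((cw j).map emb) ≠ 0
    · simp only [hC, hq, ne_eq, not_false_eq_true, if_true]; exact hHN.symm.eq
    · simp only [hC, hq, if_false]; exact hHS.symm.eq
  have hCK : ∀ j ∈ u, ∀ ψ ∈ K, C j *ᵥ ψ ∈ K := by
    intro j _ ψ hψ
    obtain ⟨hNψ, hSψ⟩ := (mem_szSector_iff _ _ ψ).1 hψ
    by_cases hq : ladderCharge ((cw j).map emb) ≠ 0
    · simp only [hC, hq, ne_eq, not_false_eq_true, if_true]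
      rw [totalNumber_mulVec_of_isNParticle hNψ]
      exact Submodule.smul_mem _ _ hψ
    · simp only [hC, hq, if_false]
      rw [hSψ]
      exact Submodule.smul_mem _ _ hψ
  have hCh : ∀ j, (C j)ᴴ = C j := by
    intro j
    by_cases hq : ladderCharge ((cw j).map emb) ≠ 0
    · simp only [hC, hq, ne_eq, not_false_eq_true, if_true]
      rw [totalNumber_eq_numberDiag_univ]
      exact numberDiag_conjTranspose _
    · simp only [hC, hq, if_false]; exact HubbardWave0.spinZ_isHermitian.eq
  have hCK' : ∀ j ∈ u, ∀ ψ ∈ K, (C j)ᴴ *ᵥ ψ ∈ K := fun j hj ψ hψ => by rw [hCh j]; exact hCK j hj ψ hψ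
  have hcharged : ∀ j ∈ u, Γ' (b j • ladderWord (cw j)) = C j * W j - W j * C j := by
    intro j hj
    rw [map_smul, hΓ', fermionEmbed_ladderWord]
    have hl : ladderCharge ((cw j).map emb) ≠ 0 ∨ ladderSpinCharge ((cw j).map emb) ≠ 0 := by
      rw [hemb, ladderCharge_map_embMap, ladderSpinCharge_map_embMap]; exact hcw j hj
    exact smul_ladderWord_eq_commutator_of_charged (b j) _ hl
  -- residual words
  set Mw : κ'' → Matrix (Finset (Orb (FermionTorus 2 L))) (Finset (Orb (FermionTorus 2 L))) ℂ :=
    fun k => ladderWord ((word k).map emb) with hMw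
  have hMc : ∀ k ∈ w, (Mw k).IsContraction := fun k _ => by
    rw [hMw]; dsimp only; rw [ladderWord_eq_prod]; exact isContraction_prod_ladder _
  -- the identity, pulled back into the torus (EOM rows by the SHARP commutator lemma)
  have htorus : X - (c : ℂ) • (1 : Matrix (Finset (Orb (FermionTorus 2 L))) (Finset (Orb (FermionTorus 2 L))) ℂ) -
      ∑ σ ∈ (Finset.univ : Finset (Fin 2)), ((μ σ : ℝ) : ℂ) • (D σ - ((ν : ℝ) : ℂ) •
        (1 : Matrix (Finset (Orb (FermionTorus 2 L))) (Finset (Orb (FermionTorus 2 L))) ℂ)) =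
      gramForm Λm (fun i => Γ' (O i)) +
        (∑ k ∈ s, (H * Γ' (fermionEmbed (PolySite.incl hΛ) (B k)) - Γ' (fermionEmbed (PolySite.incl hΛ) (B k)) * H) +
          ∑ l ∈ tt, (Us l * Yt l * (Us l)ᴴ - Yt l) +
          ∑ i ∈ (∅ : Finset (Fin 0)), ((0 : Matrix _ _ ℂ) * ((0 : Matrix _ _ ℂ) - (((0 : ℝ) : ℝ) : ℂ) • 1) +
            ((0 : Matrix _ _ ℂ) - (((0 : ℝ) : ℝ) : ℂ) • 1) * (0 : Matrix _ _ ℂ)) +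
          ∑ j ∈ u, (C j * W j - W j * C j)) +
        (∑ m' ∈ ah, ((dc m' : ℝ) : ℂ) • ((Γ' (V m'))ᴴ - Γ' (V m')) + ∑ k ∈ w, a k • Mw k) := by
    have key := congrArg Γ' hcert
    -- left-hand side
    rw [map_sub, map_sub, map_smul, map_one, map_sum] at key
    have hlhs : ∑ σ : Fin 2, Γ' (((μ σ : ℝ) : ℂ) • (nAt 0 hz σ - ((ν : ℝ) : ℂ) • (1 : FermionOp Λ'))) =
        ∑ σ ∈ (Finset.univ : Finset (Fin 2)), ((μ σ : ℝ) : ℂ) • (D σ - ((ν : ℝ) : ℂ) •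
          (1 : Matrix (Finset (Orb (FermionTorus 2 L))) (Finset (Orb (FermionTorus 2 L))) ℂ)) :=
      Finset.sum_congr rfl fun σ _ => by rw [map_smul, map_sub, map_smul, map_one, hDΓ]
    rw [hlhs] at key
    -- right-hand side, family by family
    have h1 : Γ' (∑ k ∈ s, ((hubbardTTPrimeFermionInteraction t t' U).localHamiltonian Λ' * fermionEmbed (PolySite.incl hΛ) (B k) -
        fermionEmbed (PolySite.incl hΛ) (B k) * (hubbardTTPrimeFermionInteraction t t' U).localHamiltonian Λ')) =
        ∑ k ∈ s, (H * Γ' (fermionEmbed (PolySite.incl hΛ) (B k)) - Γ' (fermionEmbed (PolySite.incl hΛ) (B k)) * H) := by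
      rw [map_sum]
      refine Finset.sum_congr rfl fun k _ => ?_
      rw [hH, hΓ', hubbardTorusTT'_commutator_fermionEmbed_sharp L t t' U hΛ h8 hInj' (B k)]
    have h2 : Γ' (∑ l ∈ tt, (fermionEmbed (PolySite.incl (hsh l)) (fermionEmbed (PolySite.shiftEmb (v l) Λ) (Y l)) -
        fermionEmbed (PolySite.incl hΛ) (Y l))) = ∑ l ∈ tt, (Us l * Yt l * (Us l)ᴴ - Yt l) := by
      rw [map_sum]
      refine Finset.sum_congr rfl fun l _ => ?_
      rw [hUs, hYt, hΓΛ, hΓ']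
      exact fermionEmbed_toTorusEmb_shift_sub hΛ (v l) (hsh l) hInj' (Y l)
    have h3 : Γ' (∑ j ∈ u, b j • ladderWord (cw j)) = ∑ j ∈ u, (C j * W j - W j * C j) := by
      rw [map_sum]
      exact Finset.sum_congr rfl hcharged
    have h4 : Γ' (∑ m' ∈ ah, ((dc m' : ℝ) : ℂ) • ((V m')ᴴ - V m')) =
        ∑ m' ∈ ah, ((dc m' : ℝ) : ℂ) • ((Γ' (V m'))ᴴ - Γ' (V m')) := by
      rw [map_sum]
      refine Finset.sum_congr rfl fun m' _ => ?_
      rw [map_smul, map_sub, hΓ', fermionEmbed_conjTranspose]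
    have h5 : Γ' (∑ k ∈ w, a k • ladderWord (word k)) = ∑ k ∈ w, a k • Mw k := by
      rw [map_sum]
      refine Finset.sum_congr rfl fun k _ => ?_
      rw [map_smul, hMw, hΓ', fermionEmbed_ladderWord]
    rw [hX, key, map_add, map_add, map_add, map_add, map_add, hΓ', fermionEmbed_gramForm, ← hΓ', h1, h2, h3, h4, h5,
      Finset.sum_empty, add_zero]
  -- apply the sector-abstracted torus engine
  have hmain := torus_minEnergyOn_sector_div_ge_of_local_certificate H hA K hK hKA hKT hKT' hAT X hsum
    (Finset.univ : Finset (Fin 2)) μ (fun _ => ν) gv D G hDsum hGh hGs hΛm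
    (fun i => Γ' (O i)) s (fun k => Γ' (fermionEmbed (PolySite.incl hΛ) (B k))) tt Us Yt hU hUK hUK' hUU
    (∅ : Finset (Fin 0)) (fun _ => 0) (fun _ => 0) (fun _ => 0) (fun _ => 0)
    (fun i hi => absurd hi (Finset.notMem_empty i)) (fun i hi => absurd hi (Finset.notMem_empty i))
    u C W hC1 hCK hCK' ah dc (fun m' => Γ' (V m')) w a Mw hMc htorus
  have hs : ∑ σ ∈ (Finset.univ : Finset (Fin 2)), μ σ * (gv σ / (L : ℝ) ^ 2 - ν) =
      μ 0 * ((nu : ℝ) / (L : ℝ) ^ 2 - ν) + μ 1 * ((nd : ℝ) / (L : ℝ) ^ 2 - ν) := by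
    rw [Fin.sum_univ_two, hgv]
    simp only [Fin.isValue, if_true, one_ne_zero, if_false]
  rw [hs] at hmain
  exact hmain

/-- **The spin exchange fixes the `t–t'` torus Hamiltonian** (both hopping graphs and the repulsion are
spin blind): `Γ H^{tt'}_L Γ⁻¹ = H^{tt'}_L`. [cite: LiebPRL1989, proof of Theorem 1] -/
theorem relabel_spinSwap_hubbardTorusTT' (L : ℕ) [NeZero L] (t t' U : ℝ) :
    relabel (Orb.spinSwap : Orb (FermionTorus 2 L) ≃ Orb (FermionTorus 2 L)) (hubbardTorusTT' L t t' U) =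
      hubbardTorusTT' L t t' U := by
  rw [hubbardTorusTT', relabel_add, relabel_spinSwap_hamiltonian, relabel_spinSwap_hamiltonian]

/-- **`E^{tt'}_L(b, a) = E^{tt'}_L(a, b)`**: the spin exchange carries the sector `(N↑, N↓) = (a, b)` of the
`t–t'` torus onto the sector `(b, a)`. [cite: LiebPRL1989, proof of Theorem 1] -/
theorem minEnergyOn_hubbardTorusTT'_spinSwap (L : ℕ) [NeZero L] (t t' U : ℝ) (a b : ℕ) :
    (hubbardTorusTT' L t t' U).minEnergyOn (szSector (b + a) (((b : ℝ) - a) / 2)) =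
      (hubbardTorusTT' L t t' U).minEnergyOn (szSector (a + b) (((a : ℝ) - b) / 2)) := by
  rw [add_comm b a, show ((b : ℝ) - a) / 2 = -(((a : ℝ) - b) / 2) by ring]
  exact minEnergyOn_szSector_neg_of_relabel_spinSwap (relabel_spinSwap_hubbardTorusTT' L t t' U) _ _

/-- **Spin-averaged form: EVERY sector `(N↑, N↓) = (a, b)` of the `t–t'` torus, density rows at the mean
filling, sharp torus hypothesis.** Averaging
`hubbardTorusTT'_minEnergyOn_upDownSector_div_ge_of_window_certificate` over `(a, b)` and `(b, a)`
(`E^{tt'}_L(b, a) = E^{tt'}_L(a, b)`):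
`c − Σ‖aₖ‖ + (Σ_σ μ_σ)((a + b)/2 / L² − ν) ≤ minEnergyOn (hubbardTorusTT' L t t' U) (szSector (a+b) ((a−b)/2)) / L²`.
At the certificate's filling `(a + b)/(2L²) = ν` the density rows drop out: the certified constant of a
translation + EOM window certificate of coordinate spread `M` is a lower bound for the energy density of
EVERY `L × L` `t–t'` torus with `L ≥ max(3, M + 1)` in every particle-number sector at that filling —
odd `a + b` and `S^z ≠ 0` included (cal-3 kernel column K7: the `3 × 3` / `4 × 4` `t' = −1/4` caps of
the classes `(≤3,≤3)` / `(4,4)`). [cite: Han2020Bootstrap, §3] [cite: XuEtAl2024, eq. (1)]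
[cite: LiebPRL1989, proof of Theorem 1] -/
theorem hubbardTorusTT'_minEnergyOn_upDownSector_div_ge_of_window_certificate_avg (t t' U : ℝ) {L : ℕ}
    [NeZero L] (hL : 3 ≤ L) {nu nd : ℕ} (hnu : nu ≤ Fintype.card (FermionTorus 2 L))
    (hnd : nd ≤ Fintype.card (FermionTorus 2 L))
    {Λ Λ' : Finset (Site 2)} (hΛ : Λ ⊆ Λ') (h8 : thicken Λ 1 ⊆ Λ')
    (h0 : thicken ({0} : Finset (Site 2)) 1 ⊆ Λ') (hz : (0 : Site 2) ∈ Λ')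
    (hInj' : Set.InjOn (Torus.proj (d := 2) L) ↑Λ')
    (μ : Fin 2 → ℝ) (ν : ℝ)
    {m : Type*} [Fintype m] [DecidableEq m] {Λm : Matrix m m ℂ} (hΛm : Λm.PosSemidef)
    (O : m → FermionOp Λ')
    {κ : Type*} (s : Finset κ) (B : κ → FermionOp Λ)
    {ι : Type*} (tt : Finset ι) (v : ι → Site 2) (hsh : ∀ l, shiftSet (v l) Λ ⊆ Λ') (Y : ι → FermionOp Λ)
    {γ : Type*} (u : Finset γ) (b : γ → ℂ) (cw : γ → List (Orb (PolySite Λ') × Bool))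
    (hcw : ∀ j ∈ u, ladderCharge (cw j) ≠ 0 ∨ ladderSpinCharge (cw j) ≠ 0)
    {δ : Type*} (ah : Finset δ) (dc : δ → ℝ) (V : δ → FermionOp Λ')
    {κ'' : Type*} (w : Finset κ'') (a : κ'' → ℂ) (word : κ'' → List (Orb (PolySite Λ') × Bool)) {c : ℝ}
    (hcert : fermionEmbed (PolySite.incl h0) ((hubbardTTPrimeFermionInteraction t t' U).meanEnergyObs 1) -
        (c : ℂ) • (1 : FermionOp Λ') -
        ∑ σ : Fin 2, ((μ σ : ℝ) : ℂ) • (nAt 0 hz σ - ((ν : ℝ) : ℂ) • (1 : FermionOp Λ')) =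
      gramForm Λm O +
        (∑ k ∈ s, ((hubbardTTPrimeFermionInteraction t t' U).localHamiltonian Λ' * fermionEmbed (PolySite.incl hΛ) (B k) -
            fermionEmbed (PolySite.incl hΛ) (B k) * (hubbardTTPrimeFermionInteraction t t' U).localHamiltonian Λ') +
          ∑ l ∈ tt, (fermionEmbed (PolySite.incl (hsh l)) (fermionEmbed (PolySite.shiftEmb (v l) Λ) (Y l)) -
            fermionEmbed (PolySite.incl hΛ) (Y l)) +
          ∑ j ∈ u, b j • ladderWord (cw j)) +
        (∑ m' ∈ ah, ((dc m' : ℝ) : ℂ) • ((V m')ᴴ - V m') + ∑ k ∈ w, a k • ladderWord (word k))) :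
    c - ∑ k ∈ w, ‖a k‖ + (∑ σ : Fin 2, μ σ) * (((nu : ℝ) + nd) / 2 / (L : ℝ) ^ 2 - ν) ≤
      (hubbardTorusTT' L t t' U).minEnergyOn (szSector (nu + nd) (((nu : ℝ) - nd) / 2)) / (L : ℝ) ^ 2 := by
  have h1 := hubbardTorusTT'_minEnergyOn_upDownSector_div_ge_of_window_certificate t t' U hL hnu hnd hΛ h8 h0 hz
    hInj' μ ν hΛm O s B tt v hsh Y u b cw hcw ah dc V w a word hcert
  have h2 := hubbardTorusTT'_minEnergyOn_upDownSector_div_ge_of_window_certificate t t' U hL hnd hnu hΛ h8 h0 hz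
    hInj' μ ν hΛm O s B tt v hsh Y u b cw hcw ah dc V w a word hcert
  rw [minEnergyOn_hubbardTorusTT'_spinSwap L t t' U nu nd] at h2
  have e : ((nu : ℝ) + nd) / 2 / (L : ℝ) ^ 2 = ((nu : ℝ) / (L : ℝ) ^ 2 + (nd : ℝ) / (L : ℝ) ^ 2) / 2 := by
    ring
  rw [Fin.sum_univ_two, e]
  linarith

/-- **The tree's conclusion under the sharp torus hypothesis**: with the data of
`groundEnergy_hubbardTorusTT'_div_ge_of_window_certificate`, for every `L ≥ 3` with `x ↦ x mod L`
injective on `Λ'` (only) and every `n ≤ L²`,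
`c − Σₖ ‖aₖ‖ + (Σ_σ μ_σ)(n/L² − ν) ≤ groundEnergy (hubbardTorusTT' L t t' U) (2n) / L²` (the sector
`(n, n)`, where the `2n`-particle ground energy is attained — Lieb 1989). [cite: Han2020Bootstrap, §3]
[cite: LiebPRL1989, proof of Theorem 1] -/
theorem hubbardTorusTT'_groundEnergy_div_ge_of_window_certificate_sharp (t t' U : ℝ) {L : ℕ} [NeZero L]
    (hL : 3 ≤ L) {nh : ℕ} (hn : nh ≤ Fintype.card (FermionTorus 2 L))
    {Λ Λ' : Finset (Site 2)} (hΛ : Λ ⊆ Λ') (h8 : thicken Λ 1 ⊆ Λ')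
    (h0 : thicken ({0} : Finset (Site 2)) 1 ⊆ Λ') (hz : (0 : Site 2) ∈ Λ')
    (hInj' : Set.InjOn (Torus.proj (d := 2) L) ↑Λ')
    (μ : Fin 2 → ℝ) (ν : ℝ)
    {m : Type*} [Fintype m] [DecidableEq m] {Λm : Matrix m m ℂ} (hΛm : Λm.PosSemidef)
    (O : m → FermionOp Λ')
    {κ : Type*} (s : Finset κ) (B : κ → FermionOp Λ)
    {ι : Type*} (tt : Finset ι) (v : ι → Site 2) (hsh : ∀ l, shiftSet (v l) Λ ⊆ Λ') (Y : ι → FermionOp Λ)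
    {γ : Type*} (u : Finset γ) (b : γ → ℂ) (cw : γ → List (Orb (PolySite Λ') × Bool))
    (hcw : ∀ j ∈ u, ladderCharge (cw j) ≠ 0 ∨ ladderSpinCharge (cw j) ≠ 0)
    {δ : Type*} (ah : Finset δ) (dc : δ → ℝ) (V : δ → FermionOp Λ')
    {κ'' : Type*} (w : Finset κ'') (a : κ'' → ℂ) (word : κ'' → List (Orb (PolySite Λ') × Bool)) {c : ℝ}
    (hcert : fermionEmbed (PolySite.incl h0) ((hubbardTTPrimeFermionInteraction t t' U).meanEnergyObs 1) -
        (c : ℂ) • (1 : FermionOp Λ') -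
        ∑ σ : Fin 2, ((μ σ : ℝ) : ℂ) • (nAt 0 hz σ - ((ν : ℝ) : ℂ) • (1 : FermionOp Λ')) =
      gramForm Λm O +
        (∑ k ∈ s, ((hubbardTTPrimeFermionInteraction t t' U).localHamiltonian Λ' * fermionEmbed (PolySite.incl hΛ) (B k) -
            fermionEmbed (PolySite.incl hΛ) (B k) * (hubbardTTPrimeFermionInteraction t t' U).localHamiltonian Λ') +
          ∑ l ∈ tt, (fermionEmbed (PolySite.incl (hsh l)) (fermionEmbed (PolySite.shiftEmb (v l) Λ) (Y l)) -
            fermionEmbed (PolySite.incl hΛ) (Y l)) +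
          ∑ j ∈ u, b j • ladderWord (cw j)) +
        (∑ m' ∈ ah, ((dc m' : ℝ) : ℂ) • ((V m')ᴴ - V m') + ∑ k ∈ w, a k • ladderWord (word k))) :
    c - ∑ k ∈ w, ‖a k‖ + (∑ σ : Fin 2, μ σ) * ((nh : ℝ) / (L : ℝ) ^ 2 - ν) ≤
      groundEnergy (hubbardTorusTT' L t t' U) (2 * nh) / (L : ℝ) ^ 2 := by
  have h := hubbardTorusTT'_minEnergyOn_upDownSector_div_ge_of_window_certificate_avg t t' U hL hn hn hΛ h8 h0 hz
    hInj' μ ν hΛm O s B tt v hsh Y u b cw hcw ah dc V w a word hcert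
  have e1 : ((nh : ℝ) + nh) / 2 = (nh : ℝ) := by ring
  have e2 : ((nh : ℝ) - nh) / 2 = 0 := by ring
  rw [e1, e2, ← two_mul, ← groundEnergy_hubbardTorusTT'_eq_minEnergyOn_szSector L t t' U hn] at h
  exact h

end TTPrimeWindowSectors

end Summit.Ventures.CertifiedManyBodySolver.Rows

end
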